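import Summits.ABC.IUTFork.FreeProSigmaUniqueRootsNoGo
import Literature.IUT.HodgeArakelov.MonoThetaProjectiveProp16EllipticRefChain
import Literature.IUT.HodgeArakelov.MonoThetaProjectiveProp16CoreRef
import Literature.AnabelianGeometry.AbsoluteAnabelian.AbsTopILem45iModelProofs
import HarnessLib

/-!
# The typed [AbsTopII] Cor. 3.3 (iii) OUTPUT record is UNINHABITED over a free pro-`Σ` `Δ` (two primes
# in `Σ`) — and so is the [IUTchII] Prop. 1.6 (ii) GENUINE output at such tempered curves

Cell `abc-iut` (run/shared/lean/pub/abc-iut/), layer L4 → L6 propagation of finding T1g11-F1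
(abc-iut-L5-t1; kernel halves abc-iut-L4-t12 `FreeProfiniteUniqueRootsNoGo.lean`, abc-iut-L4-t17
`FreeProSigmaUniqueRootsNoGo.lean`).  PROOF-ONLY (no definitions, no named facts).

* **`ellipticCuspidalization_false_of_isFreeProOn`** / `isEmpty_ellipticCuspidalization_of_isFreeProOn`
  — over an extension `E = (1 → Δ → Π → G → 1)` whose `Δ` is free pro-`Σ` of rank `≥ 2` with two
  distinct primes in `Σ`, abc-iut-L4-t6's OUTPUT record `AbsTopII.EllipticCuspidalization E` of
  [AbsTopII] Cor. 3.3 (iii) (field `torsionFree_PiD : IsMulTorsionFree ↥(Π_D ⊓ Δ_C)`, Mathlib's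
  UNIQUE-ROOTS class) DOES NOT EXIST — for ANY choice of the record's core `C`, `Π_D`, `Π_V`: the
  record's `Π_V ⊆ Π` is open with `Π_V ↪ Π_D` over the augmentations, so `Π_V ∩ Δ`, an OPEN subgroup
  of the free pro-`Σ` group `Δ` — free pro-`Σ` of rank `≥ 2` by Schreier, hence WITHOUT unique roots
  (`not_isMulTorsionFree_of_isOpen_of_isFreeProOn`) — would embed into the unique-roots group
  `Π_D ∩ Δ_C`.  This turns the prose claim "the structure is UNINHABITED [at genuine data]" of
  abc-iut-L4-t4's successor file `EllipticCuspidalizationTF.lean` into a kernel theorem, and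
  strengthens abc-iut-L4-t12's `ellipticCuspidalization_not_surjective_S3` (which constrains a GIVEN
  record) to non-existence.
* **`refIsElliptic_false_of_isFreeProOn_deltaHat`** / `isEmpty_genuine_of_isFreeProOn_deltaHat` —
  the L6 consequence: clause (R2) of abc-iut-w5-d030's successor predicate
  `EllipticCuspidalization.RefIsElliptic` ([IUTchII] Prop. 1.6 (ii)) asks for such a record over an
  `E` identified with `Π̂_X` matching `Δ̂_X`; so at every tempered curve `X` whose `Δ̂_X` is free
  pro-`Σ` of rank `≥ 2` (two primes in `Σ`) — print's `X̲̲_k` is an AFFINE hyperbolic curve —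
  `RefIsElliptic K X U eX eU` is FALSE for every `K, U, eU`, and the GENUINE output structure
  `EllipticCuspidalization.Genuine S N P X U eX` is EMPTY; likewise the v2 chain successor
  `RefIsEllipticChain` / `GenuineChain` (abc-iut, `…EllipticRefChain.lean`) and the [IUTchII]
  Prop. 1.6 (i) CORE successor `CoreData.RefIsCore` / `CoreData.Genuine` (`…CoreRef.lean`), whose
  clause (R2) asks for the same record.  In particular the T1 identity witness of
  abc-iut-L6-t21 (`MonoThetaProjectiveProp16EllipticRefIdentityWitness.nonempty_genuine_self`,
  hypothesis `htf : IsMulTorsionFree E.geom`) has an unsatisfiable hypothesis at such `X`: there the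
  typed predicate is not «content-light» but UNINHABITABLE; the repair is the same as on L4 — (R2)
  must consume the print-faithful successor record (`AbsTopII.EllipticCuspidalizationTF`,
  abc-iut-L4-t4) instead of the frozen one.
READING (numbers, not adjectives): a statement about OUR typing (`IsMulTorsionFree` for "torsion-free")
at free pro-`Σ` geometric data, `|Σ ∩ Primes| ≥ 2`; nothing here bears on [IUTchIII] Cor. 3.12 or
asserts anything about print; typed ≠ proved.
-/

noncomputable section

namespace Summit.ABC.IUTFork

open Topology Literature.AnabelianGeometry.AbsoluteAnabelian
open Literature.AnabelianGeometry.SemiGraphs (TemperedCurve)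

universe u

section L4

variable {E : FundamentalExtension.{u}} {S : Set ℕ} {n : ℕ} {gens : Fin n → ↥E.geom}

/-- **No [AbsTopII] Cor. 3.3 (iii) output record exists over an `E` whose `Δ` is free pro-`Σ` of
rank `≥ 2` with two distinct primes in `Σ`**: the record's open `Π_V ⊆ Π` gives the open subgroup
`Π_V ∩ Δ` of `Δ` — free pro-`Σ` of rank `≥ 2`, so without unique roots — embedded by the open
injection `Π ↪ Π_C` (over the augmentations, `Π_V ↦ Π_D`) into `Π_D ∩ Δ_C`, which the field
`torsionFree_PiD` types as `IsMulTorsionFree`. [cite: MochizukiAbsTopII2013, Cor 3.3 (iii) p.68] -/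
theorem ellipticCuspidalization_false_of_isFreeProOn (C : AbsTopII.EllipticCuspidalization E)
    (hfree : IsFreeProOn ↥E.geom S gens) (hn : 2 ≤ n) {p q : ℕ} (hp : p.Prime) (hq : q.Prime)
    (hpq : p ≠ q) (hpS : p ∈ S) (hqS : q ∈ S) : False := by
  let U : Subgroup ↥E.geom := C.PiV.subgroupOf E.geom
  have hU : IsOpen (U : Set ↥E.geom) := C.isOpen_PiV.preimage continuous_subtype_val
  haveI : CompactSpace ↥E.geom := isCompact_iff_compactSpace.mp E.isClosed_geom.isCompact
  have hnot := not_isMulTorsionFree_of_isOpen_of_isFreeProOn hfree hn hp hq hpq hpS hqS U hU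
  let f : ↥U →* ↥(C.PiD ⊓ C.core.geom) :=
    { toFun := fun x => ⟨C.toCore.arith (x.1 : E.arith), Subgroup.mem_inf.mpr
        ⟨C.map_PiV_le ⟨(x.1 : E.arith), Subgroup.mem_subgroupOf.mp x.2, rfl⟩,
          C.toCore.mapsTo_geom x.1.2⟩⟩
      map_one' := Subtype.ext (by simp)
      map_mul' := fun x y => Subtype.ext (by simp) }
  have hf : Function.Injective f := fun x y hxy =>
    Subtype.ext (Subtype.ext (C.toCore_isOpenInjective.arith_injective (congrArg (fun z => z.1) hxy)))
  haveI := C.torsionFree_PiD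
  exact hnot (Function.Injective.isMulTorsionFree f hf)

/-- The typed [AbsTopII] Cor. 3.3 (iii) output structure over such an `E` is EMPTY.
[cite: MochizukiAbsTopII2013, Cor 3.3 (iii) p.68] -/
theorem isEmpty_ellipticCuspidalization_of_isFreeProOn (hfree : IsFreeProOn ↥E.geom S gens)
    (hn : 2 ≤ n) {p q : ℕ} (hp : p.Prime) (hq : q.Prime) (hpq : p ≠ q) (hpS : p ∈ S)
    (hqS : q ∈ S) : IsEmpty (AbsTopII.EllipticCuspidalization E) :=
  ⟨fun C => ellipticCuspidalization_false_of_isFreeProOn C hfree hn hp hq hpq hpS hqS⟩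

/-- The free PROFINITE case (`Σ` = all primes, e.g. `Δ ≅ F̂₂` of a once-punctured elliptic curve).
[cite: MochizukiAbsTopII2013, Cor 3.3 (iii) p.68] -/
theorem isEmpty_ellipticCuspidalization_of_isFreeProOn_univ {gens : Fin n → ↥E.geom}
    (hfree : IsFreeProOn ↥E.geom Set.univ gens) (hn : 2 ≤ n) :
    IsEmpty (AbsTopII.EllipticCuspidalization E) :=
  isEmpty_ellipticCuspidalization_of_isFreeProOn hfree hn Nat.prime_two Nat.prime_three (by decide)
    (Set.mem_univ 2) (Set.mem_univ 3)

end L4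

section L6

open Literature.IUT.HodgeArakelov

variable {p : ℕ} [Fact p.Prime]

/-- Transport: an identification `iX : Π̂_X ≃ₜ* Π` matching `Δ̂_X` with `Δ` restricts to
`Δ̂_X ≃ₜ* Δ`, so `Δ` is free pro-`Σ` on the images of the generators of `Δ̂_X`.
[cite: MochizukiAbsTopI2012, Lemma 4.5 (i) p.54] -/
theorem isFreeProOn_geom_of_deltaHat (X : TemperedCurve p) {E : FundamentalExtension.{0}}
    (iX : X.PiHat ≃ₜ* E.arith) (hgeom : ∀ z : X.PiHat, iX z ∈ E.geom ↔ z ∈ X.DeltaHat)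
    {S : Set ℕ} {n : ℕ} {gens : Fin n → ↥X.DeltaHat} (hfree : IsFreeProOn ↥X.DeltaHat S gens) :
    ∃ gens' : Fin n → ↥E.geom, IsFreeProOn ↥E.geom S gens' := by
  let e : ↥X.DeltaHat ≃ₜ* ↥E.geom :=
    { toFun := fun z => ⟨iX z, (hgeom z).2 z.2⟩
      invFun := fun w => ⟨iX.symm w, (hgeom (iX.symm w)).1 (by
        rw [ContinuousMulEquiv.apply_symm_apply]; exact w.2)⟩
      left_inv := fun z => Subtype.ext (iX.symm_apply_apply z)
      right_inv := fun w => Subtype.ext (iX.apply_symm_apply w)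
      map_mul' := fun z w => Subtype.ext (map_mul iX _ _)
      continuous_toFun := (iX.continuous.comp continuous_subtype_val).subtype_mk _
      continuous_invFun := (iX.symm.continuous.comp continuous_subtype_val).subtype_mk _ }
  exact ⟨fun i => e (gens i), IsFreeProOn.of_continuousMulEquiv hfree e⟩

variable {S : ThetaSetting.{0}} {N : ℕ+} {P : TopGroup.{0}}

/-- **[IUTchII] Prop. 1.6 (ii), successor predicate `RefIsElliptic`: FALSE at every tempered curve `X`
whose `Δ̂_X` is free pro-`Σ` of rank `≥ 2` with two distinct primes in `Σ`** (clause (R2) asks for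
an [AbsTopII] Cor. 3.3 (iii) output record over an `E` with `Δ ≅ Δ̂_X`, which does not exist).
[claim: Mochizuki2012, status: disputed] (IUTchII §1 Prop 1.6 (ii), kurims p.31) -/
theorem refIsElliptic_false_of_isFreeProOn_deltaHat (K : EllipticCuspidalization S N P)
    (X U : TemperedCurve p) (eX : X.PiTemp ≃ₜ* S.PiX) (eU : U.PiTemp ≃ₜ* K.PiURef)
    {Sg : Set ℕ} {n : ℕ} {gens : Fin n → ↥X.DeltaHat} (hfree : IsFreeProOn ↥X.DeltaHat Sg gens)
    (hn : 2 ≤ n) {q₁ q₂ : ℕ} (hq₁ : q₁.Prime) (hq₂ : q₂.Prime) (hne : q₁ ≠ q₂) (h₁ : q₁ ∈ Sg)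
    (h₂ : q₂ ∈ Sg) : ¬ K.RefIsElliptic X U eX eU := by
  intro h
  obtain ⟨E, iX, C, -, -, hgeom, -⟩ := h.elliptic
  obtain ⟨gens', hfree'⟩ := isFreeProOn_geom_of_deltaHat X iX hgeom hfree
  exact ellipticCuspidalization_false_of_isFreeProOn C hfree' hn hq₁ hq₂ hne h₁ h₂

/-- **The GENUINE output structure `EllipticCuspidalization.Genuine S N P X U eX` of [IUTchII]
Prop. 1.6 (ii) (abc-iut-w5-d030) is EMPTY at every such `X`** — for all `U`; in particular the
hypotheses of abc-iut-L6-t21's identity witness `nonempty_genuine_self` (among them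
`IsMulTorsionFree E.geom`) are jointly unsatisfiable there.
[claim: Mochizuki2012, status: disputed] (IUTchII §1 Prop 1.6 (ii), kurims p.31) -/
theorem isEmpty_genuine_of_isFreeProOn_deltaHat (X U : TemperedCurve p) (eX : X.PiTemp ≃ₜ* S.PiX)
    {Sg : Set ℕ} {n : ℕ} {gens : Fin n → ↥X.DeltaHat} (hfree : IsFreeProOn ↥X.DeltaHat Sg gens)
    (hn : 2 ≤ n) {q₁ q₂ : ℕ} (hq₁ : q₁.Prime) (hq₂ : q₂.Prime) (hne : q₁ ≠ q₂) (h₁ : q₁ ∈ Sg)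
    (h₂ : q₂ ∈ Sg) : IsEmpty (EllipticCuspidalization.Genuine S N P X U eX) :=
  ⟨fun G => refIsElliptic_false_of_isFreeProOn_deltaHat G.toEllipticCuspidalization X U eX G.eU
    hfree hn hq₁ hq₂ hne h₁ h₂ G.refIsElliptic⟩

/-- The free PROFINITE case (`Σ` = all primes: `Δ̂_X ≅ F̂_n`, `n ≥ 2`, the profinite geometric
fundamental group of an affine hyperbolic curve). [claim: Mochizuki2012, status: disputed]
(IUTchII §1 Prop 1.6 (ii), kurims p.31) -/
theorem isEmpty_genuine_of_isFreeProOn_deltaHat_univ (X U : TemperedCurve p)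
    (eX : X.PiTemp ≃ₜ* S.PiX) {n : ℕ} {gens : Fin n → ↥X.DeltaHat}
    (hfree : IsFreeProOn ↥X.DeltaHat Set.univ gens) (hn : 2 ≤ n) :
    IsEmpty (EllipticCuspidalization.Genuine S N P X U eX) :=
  isEmpty_genuine_of_isFreeProOn_deltaHat X U eX hfree hn Nat.prime_two Nat.prime_three (by decide)
    (Set.mem_univ 2) (Set.mem_univ 3)

/-- The v2 chain successor `GenuineChain` (extends `Genuine` by the chain-content clause (R2′)) is
EMPTY at every such `X` as well. [claim: Mochizuki2012, status: disputed]
(IUTchII §1 Prop 1.6 (ii), kurims p.31) -/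
theorem isEmpty_genuineChain_of_isFreeProOn_deltaHat (X U : TemperedCurve p)
    (eX : X.PiTemp ≃ₜ* S.PiX) {Sg : Set ℕ} {n : ℕ} {gens : Fin n → ↥X.DeltaHat}
    (hfree : IsFreeProOn ↥X.DeltaHat Sg gens) (hn : 2 ≤ n) {q₁ q₂ : ℕ} (hq₁ : q₁.Prime)
    (hq₂ : q₂.Prime) (hne : q₁ ≠ q₂) (h₁ : q₁ ∈ Sg) (h₂ : q₂ ∈ Sg) :
    IsEmpty (EllipticCuspidalization.GenuineChain S N P X U eX) :=
  ⟨fun G => (isEmpty_genuine_of_isFreeProOn_deltaHat X U eX hfree hn hq₁ hq₂ hne h₁ h₂).false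
    G.toGenuine⟩

/-- **[IUTchII] Prop. 1.6 (i), CORE successor predicate `CoreData.RefIsCore`: FALSE at every tempered
curve `X` whose `Δ̂_X` is free pro-`Σ` of rank `≥ 2` with two distinct primes in `Σ`** — its clause
(R2) asks for the same [AbsTopII] Cor. 3.3 record over an `E` with `Δ ≅ Δ̂_X`.
[claim: Mochizuki2012, status: disputed] (IUTchII §1 Prop 1.6 (i), kurims p.31) -/
theorem refIsCore_false_of_isFreeProOn_deltaHat (Cd : CoreData S P) (X C : TemperedCurve p)
    (eX : X.PiTemp ≃ₜ* S.PiX) (eC : C.PiTemp ≃ₜ* Cd.PiCRef) {Sg : Set ℕ} {n : ℕ}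
    {gens : Fin n → ↥X.DeltaHat} (hfree : IsFreeProOn ↥X.DeltaHat Sg gens) (hn : 2 ≤ n)
    {q₁ q₂ : ℕ} (hq₁ : q₁.Prime) (hq₂ : q₂.Prime) (hne : q₁ ≠ q₂) (h₁ : q₁ ∈ Sg) (h₂ : q₂ ∈ Sg) :
    ¬ Cd.RefIsCore X C eX eC := by
  intro h
  obtain ⟨E, iX, R, -, hgeom, -⟩ := h.core
  obtain ⟨gens', hfree'⟩ := isFreeProOn_geom_of_deltaHat X iX hgeom hfree
  exact ellipticCuspidalization_false_of_isFreeProOn R hfree' hn hq₁ hq₂ hne h₁ h₂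

/-- **The GENUINE core output `CoreData.Genuine S P X C eX` of [IUTchII] Prop. 1.6 (i) is EMPTY at
every such `X`** (for all `C`). [claim: Mochizuki2012, status: disputed]
(IUTchII §1 Prop 1.6 (i), kurims p.31) -/
theorem isEmpty_coreDataGenuine_of_isFreeProOn_deltaHat (X C : TemperedCurve p)
    (eX : X.PiTemp ≃ₜ* S.PiX) {Sg : Set ℕ} {n : ℕ} {gens : Fin n → ↥X.DeltaHat}
    (hfree : IsFreeProOn ↥X.DeltaHat Sg gens) (hn : 2 ≤ n) {q₁ q₂ : ℕ} (hq₁ : q₁.Prime)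
    (hq₂ : q₂.Prime) (hne : q₁ ≠ q₂) (h₁ : q₁ ∈ Sg) (h₂ : q₂ ∈ Sg) :
    IsEmpty (CoreData.Genuine S P X C eX) :=
  ⟨fun G => refIsCore_false_of_isFreeProOn_deltaHat G.toCoreData X C eX G.eC hfree hn hq₁ hq₂ hne
    h₁ h₂ G.refIsCore⟩

end L6

end Summit.ABC.IUTFork

end
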